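import Summits.CriticalPhenomena.SAWScalingLimit.Theorems.SAWDevelopingMapInteriorFlatteningOneMouthDefs

/-!
# Named estimates of the line `one-mouth-ball-reduction` (crux `InteriorFlattening`, stmt-CriticalPhenomena-8297)

Lead prover `prover-line-stmt-CriticalPhenomena-8297-0`, after wave 1 of the line (stub analyses
`stub_reentryArmSeparation.blocked.md`, `stub_farFieldCoherence.blocked.md`, evidence on the item). This module
only NAMES, as `def … : Prop` over the objects of `…Theorems.SAWDevelopingMapInteriorFlatteningOneMouthDefs`, the
four quantitative estimates on the critical `x_c`-weighted SAW arrival law that the line's two one-scale stubs were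
found to hinge on — so that the kernel-checked CONDITIONAL reductions (`S5' ⇐ E1 + E2 + E3`, `S3' ⇐ PC`) can be
landed under `Theorems/` and the crux's census can name its atoms by declaration. NOTHING HERE IS ASSERTED: all
four are open (no RSW/BK/FKG technology for planar SAW, `n = 0`); the heuristic exponents are Coulomb-gas /
SLE₈⁄₃ values (`ρ = x₃ − x₁ = 3/2`, `κ = Δ(5/8) − Δ(0) = 25/48`).  All four carry the WINDOW of reshape r2
(`B(v,2r) ⊆ Λ`, `¬ B(v,4r) ⊆ Λ`: one-scale statements, the depth of `v` tied to the ball radius `r`).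

* `CoherentReentryGap ρ` (E1) — re-entry arm gap with COHERENT far amplitudes `‖amp_c‖` on both sides: the
  configurations of `S = B(v,r)` unclean at radius `t` carry at most `C (t/r)^ρ` of the `‖amp‖·pmass` weight;
* `CleanMonopoleLowerBound κ` (E2) — for realisable configurations clean down to `θr`, the inner monopole is at
  least `c₀ r^{-κ}` times the inner port mass (a NO-CANCELLATION statement: the open content shared with S4);
* `MonopoleDecoherence κ` (E3) — conversely the inner monopole of a configuration clean down to `t` is at most
  `C₁ t^{-κ}` times the inner port mass (same exponent; needed for the aspect-ratio tier sum of S5'(i) only);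
* `PhaseConcentration η β` (PC) — all but an `η`-fraction of the coherent weight `Σ_c ‖amp_c M_c‖` has its
  configuration phase `arg(amp_c M_c)` within `β` of a common direction (the between-configuration spread of the
  conditional mean winding is bounded; gives S3' with `A = 1/((1−η)cos β − η)` by the circular-resultant lemma).

Plus ONE API lemma, `clean_anti` (`Clean` is antitone in the radius), the registered sub-goal this module carries.
Sources: the line card `Cruxes/InteriorFlattening/Lines/one-mouth-ball-reduction.md`; H. Duminil-Copin,
S. Smirnov, Ann. of Math. 175 (2012) (arXiv:1007.0575) for the objects; B. Duplantier, H. Saleur, Phys. Rev.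
Lett. 60 (1988) 2343 and B. Nienhuis, Phys. Rev. Lett. 49 (1982) 1062 for the (non-rigorous) exponents quoted in
the docstrings only. Deliberately NOT here: any theorem about E1–E3/PC (the reductions live in their own files).
-/

noncomputable section

open scoped BigOperators
open Literature.Probability.LatticeModels Literature.Probability.RandomPlanarGeometry.SAW

namespace Summit.CriticalPhenomena.SAWScalingLimit.Theorems.InteriorFlattening.OneMouth

/-- **E1 — coherent re-entry arm gap** (NOT asserted; open). For `r ≥ r₀`, `1 ≤ t ≤ r`, in the window
`B(v,2r) ⊆ Λ ⊉ B(v,4r)`: the last-entrance configurations of `S = B(v,r)` that are unclean at radius `t`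
(three strands across `A(t,r)`, one ending at `v`) carry at most `C (t/r)^ρ` of the total weight
`Σ_c ‖amp_c‖·pmass_c`, the far amplitude `‖amp_c‖` kept COHERENT on both sides (a pure-mass bound is not
enough: the far decoherence `omass/‖amp‖` is not uniform in `Λ`). Heuristic `ρ = x₃ − x₁ = 77/48 − 5/48 = 3/2`. -/
def CoherentReentryGap (ρ : ℝ) : Prop :=
  ∃ C : ℝ, 0 ≤ C ∧ ∃ r₀ : ℝ, ∀ r : ℝ, r₀ ≤ r → ∀ t : ℝ, 1 ≤ t → t ≤ r →
    ∀ Λ : Finset HexVertex, hexDomainSimplyConnected Λ → ∀ a ∈ hexDomainBoundary Λ, ∀ v ∈ Λ,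
      Deep Λ v (2 * r) → ¬ Deep Λ v (4 * r) → ∀ w₀ w₁ w₂ : HexVertex, IsStar v w₀ w₁ w₂ →
        (∑ c ∈ (Conf Λ (ball Λ v r)).filter (fun c => ¬ Clean (ball Λ v r) c.1 v t),
            ‖amp Λ a (ball Λ v r) c‖ * pmass c.1 (root c) v w₀ w₁ w₂) ≤
          C * (t / r) ^ ρ * ∑ c ∈ Conf Λ (ball Λ v r),
            ‖amp Λ a (ball Λ v r) c‖ * pmass c.1 (root c) v w₀ w₁ w₂

/-- **E2 — clean one-mouth monopole lower bound** (NOT asserted; open; a no-cancellation statement — the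
open content it shares with the clean core S4). For every aspect `θ ∈ (0,1]` there are `c₀ > 0`, `r₀` such
that in the window, every REALISABLE configuration (`amp ≠ 0`, hence by S2 a simply connected one-mouth
sub-ball) clean down to `θr` has inner monopole `‖M_c‖ ≥ c₀ r^{-κ} · pmass_c`. Heuristic
`κ = Δ(5/8) − Δ(0) = 5/8 − 5/48 = 25/48` (tip-winding variance `(8/3) log r`). -/
def CleanMonopoleLowerBound (κ : ℝ) : Prop :=
  ∀ θ : ℝ, 0 < θ → θ ≤ 1 → ∃ c₀ : ℝ, 0 < c₀ ∧ ∃ r₀ : ℝ, ∀ r : ℝ, r₀ ≤ r →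
    ∀ Λ : Finset HexVertex, hexDomainSimplyConnected Λ → ∀ a ∈ hexDomainBoundary Λ, ∀ v ∈ Λ,
      Deep Λ v (2 * r) → ¬ Deep Λ v (4 * r) → ∀ w₀ w₁ w₂ : HexVertex, IsStar v w₀ w₁ w₂ →
        ∀ c ∈ Conf Λ (ball Λ v r), amp Λ a (ball Λ v r) c ≠ 0 →
          Clean (ball Λ v r) c.1 v (θ * r) →
            c₀ * r ^ (-κ) * pmass c.1 (root c) v w₀ w₁ w₂ ≤ ‖mono c.1 (root c) v w₀ w₁ w₂‖

/-- **E3 — monopole decoherence upper bound with the same exponent** (NOT asserted; open). In the window,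
every configuration clean down to `t ∈ [1, r]` has inner monopole `‖M_c‖ ≤ C₁ t^{-κ} · pmass_c` (the last
stretch from radius `t` to `v` runs through the clean lattice ball `B(v,t)`, where the arrival phase spreads).
Needed, with the SAME `κ` as E2, only for the dyadic tier sum behind S5'(i). -/
def MonopoleDecoherence (κ : ℝ) : Prop :=
  ∃ C₁ : ℝ, 0 ≤ C₁ ∧ ∀ r t : ℝ, 1 ≤ t → t ≤ r →
    ∀ Λ : Finset HexVertex, hexDomainSimplyConnected Λ → ∀ a ∈ hexDomainBoundary Λ, ∀ v ∈ Λ,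
      Deep Λ v (2 * r) → ¬ Deep Λ v (4 * r) → ∀ w₀ w₁ w₂ : HexVertex, IsStar v w₀ w₁ w₂ →
        ∀ c ∈ Conf Λ (ball Λ v r), Clean (ball Λ v r) c.1 v t →
          ‖mono c.1 (root c) v w₀ w₁ w₂‖ ≤ C₁ * t ^ (-κ) * pmass c.1 (root c) v w₀ w₁ w₂

/-- **PC — phase concentration of the configuration weights** (NOT asserted; open). In the window, for some
reference direction `χ₀`, the configurations `c` of `S = B(v,r)` whose weight `T_c = amp_c · M_c` has argument
farther than `β` from `χ₀` carry at most an `η`-fraction of `Σ_c ‖T_c‖` (bounded between-configuration spread of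
the conditional mean winding; false without simple connectivity — the two-corridor interferometer). With
`(1−η) cos β − η > 0`, `β ≤ π/2` it gives the windowed far-field coherence S3' with `A = 1/((1−η)cos β − η)`. -/
def PhaseConcentration (η β : ℝ) : Prop :=
  ∀ Λ : Finset HexVertex, hexDomainSimplyConnected Λ → ∀ a ∈ hexDomainBoundary Λ, ∀ v ∈ Λ,
    ∀ r : ℝ, 1 ≤ r → Deep Λ v (2 * r) → ¬ Deep Λ v (4 * r) →
    ∀ w₀ w₁ w₂ : HexVertex, IsStar v w₀ w₁ w₂ →
      ∃ χ₀ : ℝ,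
        (∑ c ∈ (Conf Λ (ball Λ v r)).filter (fun c => β <
              |Complex.arg (amp Λ a (ball Λ v r) c * mono c.1 (root c) v w₀ w₁ w₂ *
                Complex.exp (-(χ₀ : ℂ) * Complex.I))|),
            ‖amp Λ a (ball Λ v r) c * mono c.1 (root c) v w₀ w₁ w₂‖) ≤
          η * ∑ c ∈ Conf Λ (ball Λ v r), ‖amp Λ a (ball Λ v r) c * mono c.1 (root c) v w₀ w₁ w₂‖

/-! ### The one API lemma carried by this module -/

/-- **`Clean` is antitone in the radius**: a configuration with no crosscut within `t'` of `v` has none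
within `t ≤ t'`. -/
theorem clean_anti :
    ∀ (S D : Finset HexVertex) (v : HexVertex) (t t' : ℝ), t ≤ t' → Clean S D v t' → Clean S D v t :=
  fun _ _ _ _ _ h hc w hw hd => hc w hw (hd.trans h)

end Summit.CriticalPhenomena.SAWScalingLimit.Theorems.InteriorFlattening.OneMouth

end
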